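import Summits.AnomalousDissipation.AnomalousDissipation.Theorems.QuarticTightness.Negative.Anatomy
import Summits.AnomalousDissipation.AnomalousDissipation.Theorems.MomentParityMomentClosure
import Literature.Analysis.FluidPDE.GalerkinFlow
import Literature.Topology.FourManifolds.SeifertAlgebraicModelsWeierstrass

/-!
# Stub `stub_rowIdentity` (S4) of the line `horizon-shooting` (payload `Ideate3Sketch`)
# for the crux `MomentParity.QuarticTightness` (stmt-AnomalousDissipation-14331)

Sorry-free discharge of the registered stub `stub_rowIdentity` of the lead's skeleton: along an
orbit of the level-`N` Galerkin semiflow `Torus.galerkinFlow ν f N · a` of the Navier–Stokes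
equations on `T³` (smooth force `f`, `ν ≥ 0`, Galerkin mode `a` of order `N`), lifted to ANY
`H`-valued curve `U` continuous on `[0, ∞)` whose values are a.e. the orbit slices, the row
`u ↦ ⟨F(u), ∇p(u)⟩ = nsGeneratorPairing ν f u (polyGrad g P u)` of the polynomial cylindrical
observable `p(u) = P((u,g₁),…,(u,gₘ))` (band tests `gᵢ` of level `N`, real polynomial `P`) is the
exact time derivative of `t ↦ p(U t)`, so that
`∫₀ᵀ ⟨F(U t), ∇p(U t)⟩ dt = p(U T) − p(U 0)` for every `T ≥ 0`.

**Proof.** (1) Band tests are Galerkin modes of order `N` (the punctured ball is contained in the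
ball). (2) For `t ≥ 0` the coordinate `cᵢ(t) = (U t, gᵢ)` is `∫ ⟪galerkinFlow ν f N t a, gᵢ⟫`
(the pairing only sees the a.e. class). (3) The tested Galerkin equations
(`IsGalerkinMode.galerkinFlow_clauses`, clause 4) give `cᵢ(t) − cᵢ(s) = ∫ₛᵗ Gᵢ` with
`Gᵢ(τ) = ⟨F(U τ), gᵢ⟩` (`Torus.nsGeneratorPairing_eq_flux`), a continuous integrand on `[0, ∞)`
(`Torus.continuous_nsGeneratorPairing` composed with `U`). (4) Hence `cᵢ` is differentiable at every
`t > 0` with derivative `Gᵢ(t)` (FTC-1), (5) the chain rule for the polynomial `P`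
(`Literature.NumberTheory.Transcendental.hasFDerivAt_eval`) gives
`(p ∘ U)'(t) = Σᵢ ∂ᵢP(c(t)) Gᵢ(t) = ⟨F(U t), ∇p(U t)⟩` (`Torus.nsGeneratorPairing_sum_smul`), and
(6) FTC-2 on `[0, T]` (`intervalIntegral.integral_eq_sub_of_hasDerivAt_of_le`) concludes.

References: Foias–Manley–Rosa–Temam, *Navier–Stokes Equations and Turbulence* (CUP 2001), Ch. IV
§1.2 and App. B.2 (B.18) (the generator of a cylindrical functional along Galerkin orbits);
Constantin–Foias, *Navier–Stokes Equations* (Chicago 1988), Ch. 8, (8.3)–(8.6).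
-/

open MeasureTheory Filter Topology Set
open scoped ENNReal InnerProductSpace RealInnerProductSpace
open Literature.Analysis.FunctionSpaces Literature.Analysis.FluidPDE
open Summit.AnomalousDissipation.AnomalousDissipation.Theorems
open Summit.AnomalousDissipation.AnomalousDissipation.Theorems.QuarticGate.Negative
-- `T3 = UnitAddTorus (Fin 3)`, `R3 = EuclideanSpace ℝ (Fin 3)`, `H3 = ↥(Torus.energySpace (Fin 3))`, `L2T3 = ↥(Lp R3 2 volume)`
open Summit.AnomalousDissipation.AnomalousDissipation.Theorems.CubicParityLoud.Negative (T3 R3 H3 L2T3)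
set_option linter.dupNamespace false
noncomputable section

namespace Summit.AnomalousDissipation.AnomalousDissipation.Theorems.MomentParityQuarticTightness

/-- **Chain rule and FTC for a polynomial in finitely many coordinates with integral increments.**
If real functions `c i`, continuous on `[0, ∞)`, have the increments `c i t - c i 0 = ∫₀ᵗ G i`
(`t ≥ 0`) with `G i` continuous on `[0, ∞)`, then for every real polynomial `P` in `m` variables
and every `T ≥ 0`, `∫₀ᵀ Σᵢ ∂ᵢP(c(t)) Gᵢ(t) dt = P(c(T)) − P(c(0))`: each `c i` has derivative
`G i t` at `t > 0` (FTC-1), the polynomial function has derivative `Σᵢ ∂ᵢP · projᵢ`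
(`Literature.NumberTheory.Transcendental.hasFDerivAt_eval`), and FTC-2 applies on `[0, T]` with a
continuous integrand. [folklore] -/
private theorem integral_sum_pderiv_mul_eq_sub {m : ℕ} {c G : Fin m → ℝ → ℝ}
    (hc : ∀ i, ContinuousOn (c i) (Ici 0)) (hG : ∀ i, ContinuousOn (G i) (Ici 0))
    (hinc : ∀ i t, 0 ≤ t → c i t - c i 0 = ∫ τ in (0 : ℝ)..t, G i τ)
    (P : MvPolynomial (Fin m) ℝ) {T : ℝ} (hT : 0 ≤ T) :
    ∫ t in (0 : ℝ)..T, ∑ i, MvPolynomial.eval (fun j => c j t) (MvPolynomial.pderiv i P) * G i t =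
      MvPolynomial.eval (fun j => c j T) P - MvPolynomial.eval (fun j => c j 0) P := by
  -- (4) each coordinate is differentiable at interior times, with derivative `G i t`
  have hder : ∀ i t, 0 < t → HasDerivAt (c i) (G i t) t := by
    intro i t ht
    have hGo : ContinuousOn (G i) (Ioi 0) := (hG i).mono Ioi_subset_Ici_self
    have h1 : HasDerivAt (fun s => ∫ τ in (0 : ℝ)..s, G i τ) (G i t) t :=
      intervalIntegral.integral_hasDerivAt_right
        (((hG i).mono Icc_subset_Ici_self).intervalIntegrable_of_Icc ht.le)
        (hGo.stronglyMeasurableAtFilter isOpen_Ioi t ht)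
        ((hG i).continuousAt (Ici_mem_nhds ht))
    refine (h1.const_add (c i 0)).congr_of_eventuallyEq ?_
    filter_upwards [Ioi_mem_nhds ht] with s hs
    rw [← hinc i s (le_of_lt hs)]
    ring
  -- the coordinate vector `t ↦ (c j t)_j`
  have hpi : ∀ t, 0 < t → HasDerivAt (fun s => fun j => c j s) (fun j => G j t) t :=
    fun t ht => hasDerivAt_pi.2 fun j => hder j t ht
  -- (5) chain rule for the polynomial observable
  have hP : ∀ t, 0 < t → HasDerivAt (fun s => MvPolynomial.eval (fun j => c j s) P)
      (∑ i, MvPolynomial.eval (fun j => c j t) (MvPolynomial.pderiv i P) * G i t) t := by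
    intro t ht
    have h := (Literature.NumberTheory.Transcendental.hasFDerivAt_eval P
      (fun j => c j t)).comp_hasDerivAt t (hpi t ht)
    refine h.congr_deriv ?_
    simp
  -- continuity of the observable and of the row on `[0, T]`
  have hcpi : ContinuousOn (fun s => fun j => c j s) (Ici 0) := continuousOn_pi.2 hc
  have hcontP : ContinuousOn (fun s => MvPolynomial.eval (fun j => c j s) P) (Icc 0 T) :=
    ((MvPolynomial.continuous_eval P).comp_continuousOn hcpi).mono Icc_subset_Ici_self
  have hint : IntervalIntegrable (fun t => ∑ i, MvPolynomial.eval (fun j => c j t)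
      (MvPolynomial.pderiv i P) * G i t) volume 0 T := by
    refine (ContinuousOn.mono ?_ Icc_subset_Ici_self).intervalIntegrable_of_Icc hT
    exact continuousOn_finsetSum Finset.univ fun i _ =>
      ((MvPolynomial.continuous_eval (MvPolynomial.pderiv i P)).comp_continuousOn hcpi).mul (hG i)
  -- (6) FTC-2
  exact intervalIntegral.integral_eq_sub_of_hasDerivAt_of_le hT hcontP (fun t ht => hP t ht.1) hint

/-- **S4 — ROW IDENTITY ALONG THE FLOW (the row of a polynomial observable is an exact
derivative).** For `ν ≥ 0`, a smooth force `f`, a Galerkin mode `a` of order `N`, an `H`-valued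
curve `U`, continuous on `[0, ∞)`, whose value at every `t ≥ 0` is a.e. the orbit slice
`Torus.galerkinFlow ν f N t a`, band tests `gᵢ` of level `N` and a real polynomial `P`:
`∫₀ᵀ ⟨F(U t), ∇p(U t)⟩ dt = p(U T) − p(U 0)` for every `T ≥ 0`, where
`p(u) = P((u,g₁),…,(u,gₘ))` and `⟨F(u), ∇p(u)⟩ = nsGeneratorPairing ν f u (polyGrad g P u)
= Σᵢ ∂ᵢP(coords u) ⟨F(u), gᵢ⟩` (`Torus.nsGeneratorPairing_sum_smul`). Proof: band tests are
Galerkin modes of order `N`; the tested Galerkin equations (`IsGalerkinMode.galerkinFlow_clauses`,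
clause 4) with `Torus.nsGeneratorPairing_eq_flux` give `(U t, gᵢ) − (U 0, gᵢ) = ∫₀ᵗ ⟨F(U τ), gᵢ⟩ dτ`
with an integrand continuous on `[0, ∞)` (`Torus.continuous_nsGeneratorPairing ∘ U`); chain rule
for `P` and FTC-2 (`integral_sum_pderiv_mul_eq_sub`). [folklore; Foias–Manley–Rosa–Temam 2001,
Ch. IV App. B.2 (B.18); Constantin–Foias 1988, Ch. 8, (8.3)–(8.6)] -/
theorem stub_rowIdentity (ν : ℝ) (f : T3 → R3) (N : ℕ) (a : T3 → R3) (hν : 0 ≤ ν)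
    (hf : Torus.IsSmooth f) (ha : IsGalerkinMode N a) (U : ℝ → H3) (hUc : ContinuousOn U (Ici 0))
    (hU : ∀ t, 0 ≤ t → ((U t).1 : T3 → R3) =ᵐ[volume] Torus.galerkinFlow ν f N t a)
    {m : ℕ} (g : Fin m → T3 → R3) (hg : ∀ i, IsBandTest N (g i)) (P : MvPolynomial (Fin m) ℝ)
    (T : ℝ) (hT : 0 ≤ T) :
    ∫ t in (0 : ℝ)..T, Torus.nsGeneratorPairing ν f (U t) (polyGrad g P (U t)) =
      MvPolynomial.eval (fun i => Torus.pairing (U T).1 (g i)) P -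
        MvPolynomial.eval (fun i => Torus.pairing (U 0).1 (g i)) P := by
  have hf2 : MemLp f 2 volume := hf.memLp 2
  have hfi : Integrable f volume := hf.integrable
  -- (1) band tests are Galerkin modes of order `N`
  have hgal : ∀ i, IsGalerkinMode N (g i) := fun i =>
    ⟨(hg i).1, (hg i).2.1, fun k hk => (hg i).2.2.2 k fun h =>
      (Torus.not_mem_freqBall.2 hk) (Finset.mem_of_mem_erase h)⟩
  -- the row is the finite combination `Σᵢ ∂ᵢP(coords u) ⟨F(u), gᵢ⟩`
  have hrow : ∀ u : H3, Torus.nsGeneratorPairing ν f u (polyGrad g P u) =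
      ∑ i, MvPolynomial.eval (fun j => Torus.pairing u.1 (g j)) (MvPolynomial.pderiv i P) *
        Torus.nsGeneratorPairing ν f u (g i) := fun u =>
    Torus.nsGeneratorPairing_sum_smul ν hfi u Finset.univ _ fun i _ => (hg i).1
  -- the coordinates and the tested generators along the curve are continuous on `[0, ∞)`
  have hc : ∀ i, ContinuousOn (fun t => Torus.pairing (U t).1 (g i)) (Ici 0) := fun i =>
    (Torus.continuous_pairing_coe ((hg i).1.memLp 2)).comp_continuousOn hUc
  have hG : ∀ i, ContinuousOn (fun t => Torus.nsGeneratorPairing ν f (U t) (g i)) (Ici 0) :=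
    fun i => (Torus.continuous_nsGeneratorPairing ν f (hg i).1).comp_continuousOn hUc
  -- (2)–(3) tested Galerkin equations: the increments of the coordinates are the integrals of
  -- the tested generators
  have hcl := (ha.galerkinFlow_clauses hν hf2).2.2.2.1
  have hinc : ∀ i t, 0 ≤ t → Torus.pairing (U t).1 (g i) - Torus.pairing (U 0).1 (g i) =
      ∫ τ in (0 : ℝ)..t, Torus.nsGeneratorPairing ν f (U τ) (g i) := by
    intro i t ht
    have hpair : ∀ s, 0 ≤ s →
        Torus.pairing (U s).1 (g i) = ∫ x, ⟪Torus.galerkinFlow ν f N s a x, g i x⟫ := by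
      intro s hs
      simp only [Torus.pairing]
      exact integral_congr_ae ((hU s hs).mono fun x hx => by simp only [hx])
    rw [hpair t ht, hpair 0 le_rfl, hcl (g i) (hgal i) 0 t le_rfl ht]
    refine intervalIntegral.integral_congr fun τ hτ => ?_
    rw [uIcc_of_le ht] at hτ
    exact (Torus.nsGeneratorPairing_eq_flux ν hf2 (hg i).1 (hU τ hτ.1)).symm
  -- (4)–(6) chain rule and FTC
  calc ∫ t in (0 : ℝ)..T, Torus.nsGeneratorPairing ν f (U t) (polyGrad g P (U t))
      = ∫ t in (0 : ℝ)..T, ∑ i, MvPolynomial.eval (fun j => Torus.pairing (U t).1 (g j))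
          (MvPolynomial.pderiv i P) * Torus.nsGeneratorPairing ν f (U t) (g i) :=
        intervalIntegral.integral_congr fun t _ => hrow (U t)
    _ = MvPolynomial.eval (fun i => Torus.pairing (U T).1 (g i)) P -
          MvPolynomial.eval (fun i => Torus.pairing (U 0).1 (g i)) P :=
        integral_sum_pderiv_mul_eq_sub (c := fun j t => Torus.pairing (U t).1 (g j))
          (G := fun i t => Torus.nsGeneratorPairing ν f (U t) (g i)) hc hG hinc P hT

end Summit.AnomalousDissipation.AnomalousDissipation.Theorems.MomentParityQuarticTightness

end
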